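import Summits.QuantumFields.YangMills.Theorems.UnitScaleTiltProp7CovariantCurlOfGrad
import HarnessLib

/-!
# Route `UnitScaleTilt`, crux K1 «MinimiserStabilityRegPr» (stmt-QuantumFields-19200), route-R E′ path (α′) — LEMMA (S_H-SUP′), COVARIANT TWIN (P-cov1) of
# ✓ `…CentreHarmonicRegaugeSup`: the pinned re-gauging `A_H = A − D_Wψ`, `ψ = φ − φ_H`, at a CURVED background `W` in the door's letters
# (`covD ∕ covDstar ∕ divB ∕ curl ∕ plaqU` of ✓ `B9Eq39Adjoint`): divergence, `S_H`-membership and pinning are EXACT as in the flat file; the curl is no longer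
# untouched — its defect is the curvature commutator `D_WD_Wψ(p) = R(W(∂p))g − g` of ✓ `Prop7CovariantCurlOfGrad`, displayed as ONE zeroth-order row

Cell `ym3-torus`, D-0154 (3c) twin-width seat `ym-routeR-w3` (gen 5); ★p1 g14 17:25:29Z (P-cov1, first refusal routeR-w3) + 17:53:40Z «routeR-w3: P-cov1 now — GO … with the
`curl(D_Wψ) = [F,ψ]` defect as a displayed zeroth-order row».  THEOREMS ONLY (0 `def`, 0 `sorry`); `--supports stmt-QuantumFields-19200`, count-neutral.  YM₃ on T³ is a
ladder rung (R3), not the Clay problem; nothing here claims the stub, the crux, d = 4 or the gap.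

WHAT IS PROVED (ns `…Theorems.Prop7CentreHarmonicRegaugeSupCov`; abstract carrier: sites `S`, directions `ι`, shifts `T : ι → Equiv.Perm S`, background `U : ι → S → 𝔸ˣ` in a
ring ∕ normed ring `𝔸`; the door instantiates `S := Site (F.P K) 0`, `T := torusT`, `U := unitsField (toUField W)`, `𝔸 := Matrix (Fin N) (Fin N) ℂ`).
* §1 (any ring) `covD_sub_fun`, `divB_regaugeCov` (`D^*_U A_H = D^*_U A − Δ_Uψ`, `Δ_U := D^*_U D_U`), ★ `divB_regaugeCov_of_potential` (`Δ_Uφ = D^*_UA ⇒ D^*_UA_H = Δ_Uφ_H`),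
  `covLap_divB_regaugeCov_eq_zero_off` (covariant `S_H` membership from `Δ_U²φ_H = 0` off `C`), `regaugeCov_vanishes_on` (pinned), `curl_regaugeCov` (`curl A_H = curl A − D_UD_Uψ`).
* §2 (normed ring, `‖U‖, ‖U⁻¹‖ ≤ 1`) `norm_regaugeCov_le` (`‖A_H(x,μ)‖ ≤ ‖A(x,μ)‖ + ‖D_Uψ(x,μ)‖`), ★★ `norm_curl_regaugeCov_sub_le` (`‖curl A_H(p) − curl A(p)‖ ≤ 2‖W(∂p) − 1‖·‖ψ(x+e_μ+e_ν)‖`).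
* §3 ★★★ `sup_regaugeCov_le_of_rows` — under the chart row `‖A(x,μ)‖ ≤ s₀ℓ⁻¹`, the plaquette row `‖W(∂p) − 1‖ ≤ w`, and the two DISPLAYED interpolation rows
  `hInterp : ‖D_U(φ − φ_H)(x,μ)‖ ≤ c_I·ℓ·(s₁′(ℓ²)⁻¹)` (first order) and `hInterp₀ : ‖(φ − φ_H)(y)‖ ≤ c₀·ℓ²·(s₁′(ℓ²)⁻¹)` (zeroth order): (i) `‖A_H(x,μ)‖ ≤ (s₀ + c_I s₁′)ℓ⁻¹`,
  (ii) `‖curl A_H(p) − curl A(p)‖ ≤ 2w·c₀·s₁′`, (iii) `Δ_U(D^*_UA_H) = 0` off `C`, (iv) `ψ|_C = 0`.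
HONEST SCOPE.  Pure covariant bookkeeping; displayed: (E) the covariant longitudinal potential `φ` (`Δ_Uφ = D^*_UA`) and the pinned `Δ_U`-biharmonic interpolant `φ_H`;
(I)∕(I₀) the two interpolation rows = the covariant (hK) kernel bounds (★p1's (P-cov2); flat (hK) located in 19200 evidence #53, reduced to a kernel `ℓ¹` bound by
✓ `…CentreHarmonicInterpKernel`).  Constants ours; nothing of print beyond the cited tree letters is asserted.

References: T. Bałaban, CMP 99 (1985) 389–434 [Balaban1985BackgroundPropagators] ((3.1)–(3.4) pp.390–391, (3.8) p.392); CMP 99 (1985) 75–102 [Balaban1985RegularSpaces]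
((1.14) p.78, (1.36) p.82); CMP 102 (1985) 277–309 [Balaban1985Variational] (Prop. 7 p.299).
-/

set_option autoImplicit false

noncomputable section

open scoped BigOperators

namespace Summit.QuantumFields.YangMills.Theorems.Prop7CentreHarmonicRegaugeSupCov

open Literature.MathematicalPhysics.QuantumFieldTheory.Balaban1983to89
open B9Eq39Adjoint (R R_def R_add R_sub covD covDstar curl divB plaqU covD_sub covDstar_sub)
open Prop7CovariantCurlOfGrad (norm_curl_covD_le norm_covD_le)

/-! ## §1 The pinned covariant re-gauging: algebra (any ring) -/

section RingLevel

variable {𝔸 : Type*} [Ring 𝔸] {S : Type*} {ι : Type*} [Fintype ι] (T : ι → Equiv.Perm S) (U : ι → S → 𝔸ˣ)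

omit [Fintype ι] in
/-- `D_U(f − g) = D_Uf − D_Ug` as functions. [cite: Balaban1985BackgroundPropagators, (3.3) p.390] -/
theorem covD_sub_fun (μ : ι) (f g : S → 𝔸) (x : S) :
    covD T U μ (fun z => f z - g z) x = covD T U μ f x - covD T U μ g x := by
  simp only [covD, R_sub]
  abel

/-- **`D^*_U A_H = D^*_U A − Δ_U ψ`** for `A_H = A − D_Uψ`, `Δ_U := D^*_UD_U` (linearity of `D^*_U`). [cite: Balaban1985BackgroundPropagators, (3.8) p.392] -/
theorem divB_regaugeCov (A : ι → S → 𝔸) (ψ : S → 𝔸) (x : S) :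
    divB T U (fun μ z => A μ z - covD T U μ ψ z) x = divB T U A x - divB T U (fun μ z => covD T U μ ψ z) x := by
  simp only [divB, ← Finset.sum_sub_distrib]
  refine Finset.sum_congr rfl fun μ _ => ?_
  have h := covDstar_sub T U μ (A μ) (fun z => covD T U μ ψ z) x
  have hf : (fun z => A μ z - covD T U μ ψ z) = A μ - fun z => covD T U μ ψ z := rfl
  rw [hf, h]

/-- ★ **`Δ_Uφ = D^*_UA ⇒ D^*_UA_H = Δ_Uφ_H`** for `A_H = A − D_U(φ − φ_H)`. [cite: Balaban1985BackgroundPropagators, (3.8) p.392] -/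
theorem divB_regaugeCov_of_potential (A : ι → S → 𝔸) (φ φH : S → 𝔸)
    (hφ : ∀ x, divB T U (fun μ z => covD T U μ φ z) x = divB T U A x) (x : S) :
    divB T U (fun μ z => A μ z - covD T U μ (fun y => φ y - φH y) z) x = divB T U (fun μ z => covD T U μ φH z) x := by
  rw [divB_regaugeCov, ← hφ x]
  -- `D^*_U D_U (φ − φ_H) = D^*_UD_Uφ − D^*_UD_Uφ_H`
  have hlin : divB T U (fun μ z => covD T U μ (fun y => φ y - φH y) z) x
      = divB T U (fun μ z => covD T U μ φ z) x - divB T U (fun μ z => covD T U μ φH z) x := by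
    simp only [divB, ← Finset.sum_sub_distrib]
    refine Finset.sum_congr rfl fun μ _ => ?_
    have h := covDstar_sub T U μ (fun z => covD T U μ φ z) (fun z => covD T U μ φH z) x
    have hf : (fun z => covD T U μ (fun y => φ y - φH y) z) = (fun z => covD T U μ φ z) - (fun z => covD T U μ φH z) := by
      funext z; simp only [Pi.sub_apply, covD_sub_fun]
    rw [hf, h]
  rw [hlin]
  abel

/-- **COVARIANT `S_H` MEMBERSHIP**: if `φ_H` is `Δ_U`-biharmonic off `C` then `Δ_U(D^*_UA_H) = 0` off `C`. [cite: Balaban1985Variational, Prop. 7 p.299] -/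
theorem covLap_divB_regaugeCov_eq_zero_off (C : Set S) (A : ι → S → 𝔸) (φ φH : S → 𝔸)
    (hφ : ∀ x, divB T U (fun μ z => covD T U μ φ z) x = divB T U A x)
    (hEL : ∀ x ∉ C, divB T U (fun μ z => covD T U μ (fun y => divB T U (fun ν w => covD T U ν φH w) y) z) x = 0) :
    ∀ x ∉ C, divB T U (fun μ z => covD T U μ (fun y => divB T U (fun ν w => A ν w - covD T U ν (fun y' => φ y' - φH y') w) y) z) x = 0 := by
  intro x hx
  have hfun : (fun y => divB T U (fun ν w => A ν w - covD T U ν (fun y' => φ y' - φH y') w) y)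
      = fun y => divB T U (fun ν w => covD T U ν φH w) y :=
    funext fun y => divB_regaugeCov_of_potential T U A φ φH hφ y
  rw [hfun]
  exact hEL x hx

/-- the gauge function `ψ = φ − φ_H` vanishes on `C` (pinned group (1.14)). [cite: Balaban1985RegularSpaces, (1.14) p.78] -/
theorem regaugeCov_vanishes_on (C : Set S) (φ φH : S → 𝔸) (hH : ∀ y ∈ C, φH y = φ y) :
    ∀ y ∈ C, (fun y => φ y - φH y) y = 0 := fun y hy => by simp [hH y hy]

omit [Fintype ι] in
/-- **`curl A_H = curl A − D_UD_Uψ`** (linearity of the covariant curl; the second term is the curvature commutator of ✓ `Prop7CovariantCurlOfGrad`).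
[cite: Balaban1985BackgroundPropagators, (3.4) p.391] -/
theorem curl_regaugeCov (A : ι → S → 𝔸) (ψ : S → 𝔸) (μ ν : ι) (x : S) :
    curl T U (fun κ z => A κ z - covD T U κ ψ z) μ ν x = curl T U A μ ν x - curl T U (fun κ z => covD T U κ ψ z) μ ν x := by
  simp only [curl]
  have h1 := covD_sub T U μ (A ν) (fun z => covD T U ν ψ z) x
  have h2 := covD_sub T U ν (A μ) (fun z => covD T U μ ψ z) x
  simp only [Pi.sub_def] at h1 h2
  rw [h1, h2]
  abel

end RingLevel

/-! ## §2 Norms at a unitary-type background -/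

section NormLevel

variable {𝔸 : Type*} [NormedRing 𝔸] {S : Type*} {ι : Type*} [Fintype ι] (T : ι → Equiv.Perm S) (U : ι → S → 𝔸ˣ)

omit [Fintype ι] in
/-- `‖A_H(x,μ)‖ ≤ ‖A(x,μ)‖ + ‖D_Uψ(x,μ)‖`. [folklore] -/
theorem norm_regaugeCov_le (A : ι → S → 𝔸) (ψ : S → 𝔸) (μ : ι) (x : S) :
    ‖A μ x - covD T U μ ψ x‖ ≤ ‖A μ x‖ + ‖covD T U μ ψ x‖ :=
  norm_sub_le _ _

omit [Fintype ι] in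
/-- ★★ **THE CURL DEFECT OF THE RE-GAUGING IS `O(curvature × sup|ψ|)`**: `‖curl A_H(p_{μν}(x)) − curl A(p_{μν}(x))‖ ≤ 2‖W(∂p) − 1‖·‖ψ(x + e_μ + e_ν)‖` at a background with
`‖U‖, ‖U⁻¹‖ ≤ 1` and commuting shifts. [cite: Balaban1985BackgroundPropagators, (3.1)-(3.4) pp.390-391] -/
theorem norm_curl_regaugeCov_sub_le (hU : ∀ (κ : ι) (y : S), ‖(U κ y : 𝔸)‖ ≤ 1 ∧ ‖(((U κ y)⁻¹ : 𝔸ˣ) : 𝔸)‖ ≤ 1)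
    (A : ι → S → 𝔸) (ψ : S → 𝔸) (μ ν : ι) (x : S) (hT : T ν (T μ x) = T μ (T ν x)) :
    ‖curl T U (fun κ z => A κ z - covD T U κ ψ z) μ ν x - curl T U A μ ν x‖ ≤ 2 * ‖(plaqU T U μ ν x : 𝔸) - 1‖ * ‖ψ (T μ (T ν x))‖ := by
  rw [curl_regaugeCov, sub_sub_cancel_left, norm_neg]
  exact norm_curl_covD_le T U hU ψ μ ν x hT

end NormLevel

/-! ## §3 ★★★ Instantiation under the rows -/

section Rows

variable {𝔸 : Type*} [NormedRing 𝔸] {S : Type*} {ι : Type*} [Fintype ι] (T : ι → Equiv.Perm S) (U : ι → S → 𝔸ˣ)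

/-- ★★★ **LEMMA (S_H-SUP′), COVARIANT, UNDER THE ROWS**: `ℓ > 0`; background with `‖U‖, ‖U⁻¹‖ ≤ 1`, commuting shifts and plaquette row `‖W(∂p) − 1‖ ≤ w`; chart row
`‖A(x,μ)‖ ≤ s₀ℓ⁻¹`; covariant longitudinal potential `φ` (`Δ_Uφ = D^*_UA`), pinned interpolant `φ_H` of `φ|_C`, `Δ_U`-biharmonic off `C`; the displayed interpolation rows
`‖D_U(φ − φ_H)(x,μ)‖ ≤ c_I·ℓ·(s₁′(ℓ²)⁻¹)` and `‖(φ − φ_H)(y)‖ ≤ c₀·ℓ²·(s₁′(ℓ²)⁻¹)`.  Then `A_H = A − D_U(φ − φ_H)` satisfies: (i) `‖A_H(x,μ)‖ ≤ (s₀ + c_I·s₁′)·ℓ⁻¹`,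
(ii) `‖curl A_H(p) − curl A(p)‖ ≤ 2w·c₀·s₁′`, (iii) `Δ_U(D^*_UA_H) = 0` off `C`, (iv) `(φ − φ_H)|_C = 0`.
[cite: Balaban1985RegularSpaces, (1.36) p.82, (1.14) p.78; Balaban1985BackgroundPropagators, (3.1)-(3.8) pp.390-392] -/
theorem sup_regaugeCov_le_of_rows (hU : ∀ (κ : ι) (y : S), ‖(U κ y : 𝔸)‖ ≤ 1 ∧ ‖(((U κ y)⁻¹ : 𝔸ˣ) : 𝔸)‖ ≤ 1)
    (hT : ∀ (μ ν : ι) (x : S), T ν (T μ x) = T μ (T ν x))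
    (C : Set S) (A : ι → S → 𝔸) (φ φH : S → 𝔸) {s₀ s₁' cI c₀ w ℓ : ℝ} (hℓ : 0 < ℓ)
    (hplaq : ∀ (μ ν : ι) (x : S), ‖(plaqU T U μ ν x : 𝔸) - 1‖ ≤ w)
    (hA : ∀ (μ : ι) (x : S), ‖A μ x‖ ≤ s₀ * ℓ⁻¹)
    (hφ : ∀ x, divB T U (fun μ z => covD T U μ φ z) x = divB T U A x) (hH : ∀ y ∈ C, φH y = φ y)
    (hEL : ∀ x ∉ C, divB T U (fun μ z => covD T U μ (fun y => divB T U (fun ν w' => covD T U ν φH w') y) z) x = 0)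
    (hInterp : ∀ (μ : ι) (x : S), ‖covD T U μ (fun y => φ y - φH y) x‖ ≤ cI * ℓ * (s₁' * (ℓ ^ 2)⁻¹))
    (hInterp₀ : ∀ y, ‖φ y - φH y‖ ≤ c₀ * ℓ ^ 2 * (s₁' * (ℓ ^ 2)⁻¹)) :
    (∀ (μ : ι) (x : S), ‖A μ x - covD T U μ (fun y => φ y - φH y) x‖ ≤ (s₀ + cI * s₁') * ℓ⁻¹)
      ∧ (∀ (μ ν : ι) (x : S), ‖curl T U (fun κ z => A κ z - covD T U κ (fun y => φ y - φH y) z) μ ν x - curl T U A μ ν x‖ ≤ 2 * w * (c₀ * s₁'))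
      ∧ (∀ x ∉ C, divB T U (fun μ z => covD T U μ (fun y => divB T U (fun ν w' => A ν w' - covD T U ν (fun y' => φ y' - φH y') w') y) z) x = 0)
      ∧ (∀ y ∈ C, (fun y => φ y - φH y) y = 0) := by
  refine ⟨fun μ x => ?_, fun μ ν x => ?_, covLap_divB_regaugeCov_eq_zero_off T U C A φ φH hφ hEL, regaugeCov_vanishes_on C φ φH hH⟩
  · have e : s₀ * ℓ⁻¹ + cI * ℓ * (s₁' * (ℓ ^ 2)⁻¹) = (s₀ + cI * s₁') * ℓ⁻¹ := by
      field_simp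
    exact (norm_regaugeCov_le T U A _ μ x).trans ((add_le_add (hA μ x) (hInterp μ x)).trans_eq e)
  · have hw : 0 ≤ w := (norm_nonneg _).trans (hplaq μ ν x)
    have h0 : ‖φ (T μ (T ν x)) - φH (T μ (T ν x))‖ ≤ c₀ * s₁' := by
      have e : c₀ * ℓ ^ 2 * (s₁' * (ℓ ^ 2)⁻¹) = c₀ * s₁' := by field_simp
      exact (hInterp₀ _).trans_eq e
    calc ‖curl T U (fun κ z => A κ z - covD T U κ (fun y => φ y - φH y) z) μ ν x - curl T U A μ ν x‖
        ≤ 2 * ‖(plaqU T U μ ν x : 𝔸) - 1‖ * ‖φ (T μ (T ν x)) - φH (T μ (T ν x))‖ :=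
          norm_curl_regaugeCov_sub_le T U hU A _ μ ν x (hT μ ν x)
      _ ≤ 2 * w * (c₀ * s₁') := by
          refine mul_le_mul (mul_le_mul_of_nonneg_left (hplaq μ ν x) (by norm_num)) h0 (norm_nonneg _) (by positivity)

end Rows

end Summit.QuantumFields.YangMills.Theorems.Prop7CentreHarmonicRegaugeSupCov
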